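import Literature.Analysis.FluidPDE.SereginZhou2020WeakL4
import Literature.Analysis.FluidPDE.SereginZhou2020
import Literature.Analysis.FluidPDE.CKNInterpolationEstimate
import HarnessLib

/-!
# Seregin–Zhou 2020, Lemma 2.4: the cubic quantity `C(r)` controlled by `A(2r) + E(2r)` to the
# power `3/4` for `L^∞(0,T; Ḃ^{-1}_{∞,∞})` solutions

Analysis/FluidPDE proof file (theorems only; no definitions, no named facts) on the way to the
corrected form of Seregin–Zhou 2020, Thm 1.2 (`SereginZhou2020.lean`; G. Seregin, D. Zhou,
J. Math. Sci. 244 (2020) = arXiv:1802.03600). It proves the tree's version of their Lemma 2.4,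
estimate (C) (p. 4): under `SereginZhou2020.Hypotheses T v q G` and the heat-flow bound
`HeatBesovBound M (v t)` for a.e. `t ∈ (0,T)`, for every backward cylinder
`Q(z, 2r) ⊆ [0,T] × ℝ³`,

  `C(r; z) ≤ c · max(M,1)^{3/2} · (A_ess(2r; z) + E(2r; z))^{3/4}`

(`exists_cknC_le_rpow_three_quarters`; `C = cknC`, `A_ess = cknAEss`, `E = cknE`), with an
absolute `c`. Printed: `C(z₀,r) ≤ c ‖u‖^{3/2}_{L∞(0,T;Ḃ^{-1}_{∞,∞})} (A^{3/4}(z₀,2r) + E^{3/4}(z₀,2r))`.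

## Proof (Seregin–Zhou 2020, proof of Lemma 2.4, with Lemma 2.3 in the heat-flow form)

For a.e. `t` in the window of `Q(z, r)` the slice `v(t)` has the weak derivative `G(t)` on
`ℝ³` (`HasWeakSpatialGradientOn.ae_hasWeakFDerivOn_slice`), satisfies the heat-flow bound with
constant `M` (hence with `max(M,1) > 0`) and is integrable against Gaussians, and
`∫_{B(x,2r)} |v(t)|² ≤ 2r A_ess(2r)`. The local `L³` bound
`SereginZhouWeakL4.exists_lintegral_ball_enorm_pow_three_le` gives
`∫_{B(x,r)} |v(t)|³ ≤ C |B_r|^{1/4} max(M,1)^{3/2} (e(t) + r⁻² a(t))^{3/4}` with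
`a(t) = ∫_{B(x,2r)}|v(t)|²`, `e(t) = ∫_{B(x,2r)}|G(t)|²`; integrating in `t` and applying
Hölder in time (`∫_I F^{3/4} ≤ |I|^{1/4} (∫_I F)^{3/4}`, `|I| = r²`) yields
`r² C(r) ≤ C' max(M,1)^{3/2} r^{3/4} r^{1/2} (2r (A_ess + E))^{3/4}`, i.e. the claim.

## References

* G. Seregin, D. Zhou, J. Math. Sci. 244 (2020) = arXiv:1802.03600, Lemma 2.4 (C) and its
  proof, Lemma 2.3. [`SereginZhou2020`]
-/

noncomputable section

open MeasureTheory Set Function Filter Topology Metric TopologicalSpace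
open scoped ENNReal NNReal

namespace Literature.Analysis.FluidPDE

open Literature.Analysis.UnboundedOperators

namespace SereginZhou2020

/-! ### Hölder in time and slice facts -/

/-- Hölder in time against the constant `1`: `∫ f^{3/4} ≤ (μ univ)^{1/4} (∫ f)^{3/4}`.
[folklore] -/
theorem lintegral_rpow_three_quarters_le_mul {α : Type*} [MeasurableSpace α] (μ : Measure α)
    {f : α → ℝ≥0∞} (hf : AEMeasurable f μ) :
    ∫⁻ x, f x ^ (3 / 4 : ℝ) ∂μ ≤ (μ univ) ^ (1 / 4 : ℝ) * (∫⁻ x, f x ∂μ) ^ (3 / 4 : ℝ) := by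
  have hpq : (4 / 3 : ℝ).HolderConjugate 4 := Real.holderConjugate_iff.2 ⟨by norm_num, by norm_num⟩
  have key := ENNReal.lintegral_mul_le_Lp_mul_Lq μ hpq (hf.pow_const (3 / 4 : ℝ))
    (g := fun _ => 1) aemeasurable_const
  have h2 : ∀ x, (f x ^ (3 / 4 : ℝ)) ^ (4 / 3 : ℝ) = f x := fun x => by
    rw [← ENNReal.rpow_mul, show (3 / 4 : ℝ) * (4 / 3) = 1 by norm_num, ENNReal.rpow_one]
  simp only [Pi.mul_apply, mul_one, h2, ENNReal.one_rpow, lintegral_const, one_mul] at key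
  rw [show (1 : ℝ) / (4 / 3) = 3 / 4 by norm_num] at key
  rw [mul_comm]
  exact key

/-- **Gaussian integrability from the heat-flow bound.** `HeatBesovBound M f` makes `f`
integrable against every centred Gaussian (its first clause at the centre `0`; the kernel is
even). [folklore] -/
theorem HeatBesovBound.integrable_heatKernel_mul_norm {M : ℝ}
    {f : EuclideanSpace ℝ (Fin 3) → EuclideanSpace ℝ (Fin 3)} (h : HeatBesovBound M f) {a : ℝ}
    (ha : 0 < a) : Integrable (fun y => heatKernel a y * ‖f y‖) volume := by
  have h1 := (h a ha 0).1.norm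
  have h2 := h1.comp_neg
  refine h2.congr (Eventually.of_forall fun y => ?_)
  simp [norm_smul, heatKernel_neg, Real.norm_of_nonneg (heatKernel_pos ha _).le]

/-- **The heat-flow bound in rescaled form**: `HeatBesovBound M f` gives
`‖e^{sΔ}f(y)‖ ≤ max(M,1) s^{-1/2}`. [folklore] -/
theorem HeatBesovBound.norm_heatExtension_le {M : ℝ}
    {f : EuclideanSpace ℝ (Fin 3) → EuclideanSpace ℝ (Fin 3)} (h : HeatBesovBound M f) {s : ℝ}
    (hs : 0 < s) (y : EuclideanSpace ℝ (Fin 3)) :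
    ‖heatExtension f s y‖ ≤ max M 1 * s ^ (-(1 / 2 : ℝ)) := by
  have h2 := (h s hs y).2
  have hsq : 0 < Real.sqrt s := Real.sqrt_pos.2 hs
  have e : s ^ (-(1 / 2 : ℝ)) = (Real.sqrt s)⁻¹ := by
    rw [Real.sqrt_eq_rpow, ← Real.rpow_neg hs.le]
  rw [e, ← div_eq_mul_inv, le_div_iff₀ hsq, mul_comm]
  exact h2.trans (le_max_left _ _)

/-! ### The cubic estimate -/

/-- Backward cylinders `Q(z, R)` with `0 ≤ t_z − R²` and `t_z ≤ T` lie in the slab `(0,T) × ℝ³`.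
[folklore] -/
theorem parabolicCylinderOpens_le_slab {T R : ℝ} {z : ℝ × EuclideanSpace ℝ (Fin 3)}
    (h0 : 0 ≤ z.1 - R ^ 2) (hT : z.1 ≤ T) :
    parabolicCylinderOpens R z ≤ slab (EuclideanSpace ℝ (Fin 3)) (Ioo 0 T) isOpen_Ioo := by
  intro q hq
  change q ∈ parabolicCylinder R z at hq
  rw [mem_parabolicCylinder] at hq
  exact mem_slab.2 ⟨by linarith [hq.1.1], lt_of_lt_of_le hq.1.2 hT⟩

/-- **Local `L³` bound on a backward cylinder from the data of the fat cylinder above it**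
(Seregin–Zhou 2020, proof of Lemma 2.4 (C), before normalisation). There is an absolute `c`
such that: under `Hypotheses T v q G`, if `HeatBesovBound M (v t)` holds for a.e. `t ∈ (0,T)`,
then for every backward cylinder `Q(z, r) = I × B(x, r)`, `I = (t − r², t)`, with `0 ≤ t − r²`,
`t ≤ T`, and every `Λ` with `∫_{B(x,2r)} |v(s)|² ≤ Λ` for a.e. `s ∈ I`,
`∫_{Q(z,r)} |v|³ ≤ c · max(M,1)^{3/2} · r^{5/4} · (∫_{I × B(x,2r)} |G|² + Λ)^{3/4}`.
[cite: SereginZhou2020, proof of Lemma 2.4 (C)] -/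
theorem exists_lintegral_parabolicCylinder_enorm_pow_three_le :
    ∃ c : ℝ≥0, ∀ (T : ℝ) (v : ℝ → EuclideanSpace ℝ (Fin 3) → EuclideanSpace ℝ (Fin 3))
      (q : ℝ → EuclideanSpace ℝ (Fin 3) → ℝ)
      (G : ℝ → EuclideanSpace ℝ (Fin 3) → EuclideanSpace ℝ (Fin 3) →L[ℝ] EuclideanSpace ℝ (Fin 3))
      (M : ℝ), Hypotheses T v q G →
      (∀ᵐ t : ℝ, t ∈ Ioo 0 T → HeatBesovBound M (v t)) →
      ∀ (z : ℝ × EuclideanSpace ℝ (Fin 3)) (r : ℝ) (Λ : ℝ≥0∞), 0 < r → 0 ≤ z.1 - r ^ 2 →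
        z.1 ≤ T →
        (∀ᵐ s ∂(volume.restrict (Ioo (z.1 - r ^ 2) z.1)),
          ∫⁻ y in ball z.2 (2 * r), ‖v s y‖ₑ ^ 2 ≤ Λ) →
        ∫⁻ p in parabolicCylinder r z, ‖v p.1 p.2‖ₑ ^ (3 : ℕ) ≤
          c * ENNReal.ofReal (max M 1) ^ (3 / 2 : ℝ) * ENNReal.ofReal r ^ (5 / 4 : ℝ) *
            ((∫⁻ p in Ioo (z.1 - r ^ 2) z.1 ×ˢ ball z.2 (2 * r),
                ENNReal.ofReal (frobeniusNormSq (G p.1 p.2))) + Λ) ^ (3 / 4 : ℝ) := by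
  obtain ⟨C, hC⟩ := SereginZhouWeakL4.exists_lintegral_ball_enorm_pow_three_le
    (E := EuclideanSpace ℝ (Fin 3))
  set V₁ : ℝ≥0∞ := volume (ball (0 : EuclideanSpace ℝ (Fin 3)) 1) with hV₁
  have hV₁top : V₁ ≠ ⊤ := measure_ball_lt_top.ne
  -- the constant: `c = C V₁^{1/4} + 1`
  set c : ℝ≥0 := C * (V₁ ^ (1 / 4 : ℝ)).toNNReal + 1 with hc
  have hcE : (c : ℝ≥0∞) = (C : ℝ≥0∞) * V₁ ^ (1 / 4 : ℝ) + 1 := by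
    rw [hc, ENNReal.coe_add, ENNReal.coe_mul, ENNReal.coe_one, ENNReal.coe_toNNReal
      (ENNReal.rpow_ne_top_of_nonneg (by norm_num) hV₁top)]
  have hc0 : (c : ℝ≥0∞) ≠ 0 := by rw [hc]; simp
  refine ⟨c, fun T v q G M hyp hM z r Λ hr hz0 hzT hΛ => ?_⟩
  set M' : ℝ := max M 1 with hM'
  have hM'0 : 0 < M' := lt_of_lt_of_le one_pos (le_max_right _ _)
  have hM'e : ENNReal.ofReal M' ≠ 0 := by simpa using hM'0
  -- notation
  set t₀ : ℝ := z.1 with ht₀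
  set x₀ : EuclideanSpace ℝ (Fin 3) := z.2 with hx₀
  set I : Set ℝ := Ioo (t₀ - r ^ 2) t₀ with hI
  set B : Set (EuclideanSpace ℝ (Fin 3)) := ball x₀ r with hB
  set B₂ : Set (EuclideanSpace ℝ (Fin 3)) := ball x₀ (2 * r) with hB₂
  set Θ : ℝ≥0∞ := ∫⁻ p in I ×ˢ B₂, ENNReal.ofReal (frobeniusNormSq (G p.1 p.2)) with hΘ
  -- degenerate cases
  have hρ0 : ENNReal.ofReal r ≠ 0 := by simpa using hr
  have hρtop : ENNReal.ofReal r ≠ ⊤ := ENNReal.ofReal_ne_top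
  have hRHS_top : (c : ℝ≥0∞) * ENNReal.ofReal M' ^ (3 / 2 : ℝ) * ENNReal.ofReal r ^ (5 / 4 : ℝ) *
      (⊤ : ℝ≥0∞) ^ (3 / 4 : ℝ) = ⊤ := by
    rw [ENNReal.top_rpow_of_pos (by norm_num), ENNReal.mul_top]
    exact mul_ne_zero (mul_ne_zero hc0
      (ENNReal.rpow_pos (pos_iff_ne_zero.2 hM'e) ENNReal.ofReal_ne_top).ne')
      (ENNReal.rpow_pos (pos_iff_ne_zero.2 hρ0) hρtop).ne'
  by_cases hΘtop : Θ = ⊤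
  · rw [hΘtop, top_add, hRHS_top]; exact le_top
  by_cases hΛtop : Λ = ⊤
  · rw [hΛtop, add_top, hRHS_top]; exact le_top
  -- geometry
  have hr2 : 0 < 2 * r := by positivity
  have hIT : I ⊆ Ioo 0 T := fun s hs => ⟨by linarith [hs.1], lt_of_lt_of_le hs.2 hzT⟩
  have hQ₁ : parabolicCylinder r z = I ×ˢ B := by
    simp [parabolicCylinder, hI, hB, ht₀, hx₀]
  have hQ₁₂ : I ×ˢ B ⊆ I ×ˢ B₂ := prod_mono le_rfl (ball_subset_ball (by linarith))
  have hQsub : I ×ˢ B₂ ⊆ ((slab (EuclideanSpace ℝ (Fin 3)) (Ioo 0 T) isOpen_Ioo :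
      Opens (ℝ × EuclideanSpace ℝ (Fin 3))) : Set (ℝ × EuclideanSpace ℝ (Fin 3))) :=
    fun p hp => mem_slab.2 (hIT hp.1)
  -- measurability
  have hum : AEStronglyMeasurable (uncurry v) (volume.restrict (I ×ˢ B₂)) :=
    (hyp.weakGradient.locallyIntegrableOn.mono_set hQsub).aestronglyMeasurable
  have hGm : AEStronglyMeasurable (uncurry G) (volume.restrict (I ×ˢ B₂)) :=
    (hyp.weakGradient.locallyIntegrableOn_grad.mono_set hQsub).aestronglyMeasurable
  have hprod₂ : (volume.restrict (I ×ˢ B₂) : Measure (ℝ × EuclideanSpace ℝ (Fin 3))) =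
      (volume.restrict I).prod (volume.restrict B₂) := by
    rw [Measure.volume_eq_prod, Measure.prod_restrict]
  have hprod₁ : (volume.restrict (I ×ˢ B) : Measure (ℝ × EuclideanSpace ℝ (Fin 3))) =
      (volume.restrict I).prod (volume.restrict B) := by
    rw [Measure.volume_eq_prod, Measure.prod_restrict]
  have hum2 : AEMeasurable (fun p : ℝ × EuclideanSpace ℝ (Fin 3) => ‖v p.1 p.2‖ₑ ^ (2 : ℕ))
      ((volume.restrict I).prod (volume.restrict B₂)) := by
    rw [← hprod₂]; exact hum.enorm.pow_const 2
  have hGm2 : AEMeasurable (fun p : ℝ × EuclideanSpace ℝ (Fin 3) =>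
      ENNReal.ofReal (frobeniusNormSq (G p.1 p.2))) ((volume.restrict I).prod (volume.restrict B₂)) := by
    rw [← hprod₂]
    exact (continuous_frobeniusNormSq'.comp_aestronglyMeasurable hGm).aemeasurable.ennreal_ofReal
  have hum3 : AEMeasurable (fun p : ℝ × EuclideanSpace ℝ (Fin 3) => ‖v p.1 p.2‖ₑ ^ (3 : ℕ))
      ((volume.restrict I).prod (volume.restrict B)) := by
    rw [← hprod₁]; exact (hum.mono_measure (Measure.restrict_mono hQ₁₂ le_rfl)).enorm.pow_const 3
  -- the slice integrals
  set a : ℝ → ℝ≥0∞ := fun s => ∫⁻ y in B₂, ‖v s y‖ₑ ^ 2 with ha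
  set e : ℝ → ℝ≥0∞ := fun s => ∫⁻ y in B₂, ENNReal.ofReal (frobeniusNormSq (G s y)) with he
  set cc : ℝ → ℝ≥0∞ := fun s => ∫⁻ y in B, ‖v s y‖ₑ ^ (3 : ℕ) with hcc
  have ham : AEMeasurable a (volume.restrict I) := hum2.lintegral_prod_right'
  have hem : AEMeasurable e (volume.restrict I) := hGm2.lintegral_prod_right'
  -- Tonelli
  have hΘeq : Θ = ∫⁻ s in I, e s := by
    rw [hΘ, Measure.volume_eq_prod,
      setLIntegral_prod _ (by rw [← Measure.prod_restrict]; exact hGm2)]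
  have hCeq : ∫⁻ p in parabolicCylinder r z, ‖v p.1 p.2‖ₑ ^ (3 : ℕ) = ∫⁻ s in I, cc s := by
    rw [hQ₁, Measure.volume_eq_prod,
      setLIntegral_prod _ (by rw [← Measure.prod_restrict]; exact hum3)]
  -- a.e. in time on `I`
  have h1 : ∀ᵐ s ∂(volume.restrict I), a s ≤ Λ := hΛ
  have h2 : ∀ᵐ s ∂(volume.restrict I), e s < ⊤ :=
    ae_lt_top' hem (by rw [← hΘeq]; exact hΘtop)
  have h3 : ∀ᵐ s ∂(volume.restrict I),
      FunctionSpaces.HasWeakFDerivOn ⊤ volume (v s) (G s) := by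
    have h := HasWeakSpatialGradientOn.ae_hasWeakFDerivOn_slice
      (Ω := (⊤ : Opens (EuclideanSpace ℝ (Fin 3)))) (a := 0) (b := T) (u := v) (G := G)
      (by simpa [slab] using hyp.weakGradient)
    exact ae_restrict_of_ae_restrict_of_subset hIT h
  have h4 : ∀ᵐ s ∂(volume.restrict I), HeatBesovBound M (v s) :=
    ae_restrict_of_ae_restrict_of_subset hIT ((ae_restrict_iff' measurableSet_Ioo).2 hM)
  -- the pointwise-in-time estimate
  set V : ℝ≥0∞ := volume (ball x₀ r) with hV
  set K : ℝ≥0∞ := C * V ^ (1 / 4 : ℝ) * ENNReal.ofReal M' ^ (3 / 2 : ℝ) with hK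
  have hpt : ∀ᵐ s ∂(volume.restrict I),
      cc s ≤ K * (e s + (ENNReal.ofReal r)⁻¹ ^ 2 * a s) ^ (3 / 4 : ℝ) := by
    filter_upwards [h1, h2, h3, h4] with s has hes hws hbs
    have has' : a s ≠ ⊤ := ne_top_of_le_ne_top hΛtop has
    -- data of the slice
    have hfm : AEStronglyMeasurable (v s) volume := by
      have := hws.locallyIntegrableOn.aestronglyMeasurable
      rwa [Opens.coe_top, Measure.restrict_univ] at this
    have hGauss : ∀ a' : ℝ, 0 < a' → Integrable (fun y => heatKernel a' y * ‖v s y‖) volume :=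
      fun a' ha' => hbs.integrable_heatKernel_mul_norm ha'
    have hMb : ∀ s' : ℝ, 0 < s' → ∀ y, ‖heatExtension (v s) s' y‖ ≤ M' * s' ^ (-(1 / 2 : ℝ)) :=
      fun s' hs' y => hbs.norm_heatExtension_le hs' y
    have hwB : FunctionSpaces.HasWeakFDerivOn (⟨ball x₀ (2 * r), isOpen_ball⟩ : Opens _) volume (v s) (G s) :=
      FunctionSpaces.HasWeakFDerivOn.mono_set_holds hws le_top
    have hL2 : eLpNorm (v s) 2 (volume.restrict B₂) = a s ^ (1 / 2 : ℝ) := by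
      rw [eLpNorm_eq_lintegral_rpow_enorm_toReal two_ne_zero ENNReal.ofNat_ne_top,
        ENNReal.toReal_ofNat, ha]
      simp only [one_div]
      congr 1
      refine lintegral_congr fun x => ?_
      rw [show (2 : ℝ) = ((2 : ℕ) : ℝ) by norm_num, ENNReal.rpow_natCast]
    have hf2 : MemLp (v s) 2 (volume.restrict B₂) := by
      refine ⟨hwB.locallyIntegrableOn.aestronglyMeasurable, ?_⟩
      rw [hL2]; exact ENNReal.rpow_lt_top_of_nonneg (by norm_num) has'
    have key := hC (v s) (G s) M' x₀ r hM'0 hr hfm hGauss hMb hwB hf2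
    refine key.trans ?_
    rw [← hK]
    refine mul_le_mul_right (ENNReal.rpow_le_rpow (add_le_add ?_ ?_) (by norm_num)) _
    · have hg := eLpNorm_two_le_lintegral_frobeniusNormSq_rpow (volume.restrict B₂) (G s)
      calc eLpNorm (G s) 2 (volume.restrict B₂) ^ 2
          ≤ ((∫⁻ x in B₂, ENNReal.ofReal (frobeniusNormSq (G s x))) ^ (1 / 2 : ℝ)) ^ 2 :=
            pow_le_pow_left₀ zero_le hg 2
        _ = e s := by
            rw [← ENNReal.rpow_two, ← ENNReal.rpow_mul, he]; norm_num
    · have e2 : (a s ^ (1 / 2 : ℝ)) ^ 2 = a s := by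
        rw [← ENNReal.rpow_two, ← ENNReal.rpow_mul]; norm_num
      rw [hL2, e2]
  -- integrate in time
  have hvolI : (volume.restrict I : Measure ℝ) univ = ENNReal.ofReal (r ^ 2) := by
    rw [Measure.restrict_apply_univ, hI, Real.volume_Ioo]; ring_nf
  have hFm : AEMeasurable (fun s => e s + (ENNReal.ofReal r)⁻¹ ^ 2 * a s) (volume.restrict I) :=
    hem.add (ham.const_mul _)
  have hint_a : ∫⁻ s in I, (ENNReal.ofReal r)⁻¹ ^ 2 * a s ≤ Λ := by
    calc ∫⁻ s in I, (ENNReal.ofReal r)⁻¹ ^ 2 * a s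
        ≤ ∫⁻ _ in I, (ENNReal.ofReal r)⁻¹ ^ 2 * Λ := by
          refine lintegral_mono_ae ?_
          filter_upwards [h1] with s hs
          exact mul_le_mul_right hs _
      _ = (ENNReal.ofReal r)⁻¹ ^ 2 * Λ * ENNReal.ofReal (r ^ 2) := by
          rw [lintegral_const, hvolI]
      _ = Λ := by
          have hrr : (ENNReal.ofReal r)⁻¹ ^ 2 * ENNReal.ofReal (r ^ 2) = 1 := by
            rw [ENNReal.ofReal_pow hr.le, ← mul_pow, ENNReal.inv_mul_cancel hρ0
              ENNReal.ofReal_ne_top, one_pow]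
          calc (ENNReal.ofReal r)⁻¹ ^ 2 * Λ * ENNReal.ofReal (r ^ 2)
              = ((ENNReal.ofReal r)⁻¹ ^ 2 * ENNReal.ofReal (r ^ 2)) * Λ := by ring
            _ = _ := by rw [hrr, one_mul]
  have hint : ∫⁻ s in I, (e s + (ENNReal.ofReal r)⁻¹ ^ 2 * a s) ≤ Θ + Λ := by
    rw [lintegral_add_left' hem, ← hΘeq]
    exact add_le_add le_rfl hint_a
  have hIc : ∫⁻ s in I, cc s ≤ K * (ENNReal.ofReal (r ^ 2) ^ (1 / 4 : ℝ) * (Θ + Λ) ^ (3 / 4 : ℝ)) := by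
    calc ∫⁻ s in I, cc s ≤ ∫⁻ s in I, K * (e s + (ENNReal.ofReal r)⁻¹ ^ 2 * a s) ^ (3 / 4 : ℝ) :=
          lintegral_mono_ae hpt
      _ = K * ∫⁻ s in I, (e s + (ENNReal.ofReal r)⁻¹ ^ 2 * a s) ^ (3 / 4 : ℝ) := by
          rw [lintegral_const_mul'' _ (hFm.pow_const _)]
      _ ≤ K * ((volume.restrict I) univ ^ (1 / 4 : ℝ) *
            (∫⁻ s in I, (e s + (ENNReal.ofReal r)⁻¹ ^ 2 * a s)) ^ (3 / 4 : ℝ)) :=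
          mul_le_mul_right (lintegral_rpow_three_quarters_le_mul _ hFm) _
      _ ≤ K * (ENNReal.ofReal (r ^ 2) ^ (1 / 4 : ℝ) * (Θ + Λ) ^ (3 / 4 : ℝ)) := by
          rw [hvolI]
          exact mul_le_mul_right (mul_le_mul_right (ENNReal.rpow_le_rpow hint (by norm_num)) _) _
  -- collect the powers of `r`
  have hVeq : V = ENNReal.ofReal (r ^ 3) * V₁ := by
    rw [hV, Measure.addHaar_ball_of_pos volume x₀ hr, finrank_euclideanSpace_fin]
  have hpow : ENNReal.ofReal (r ^ 3) ^ (1 / 4 : ℝ) * ENNReal.ofReal (r ^ 2) ^ (1 / 4 : ℝ) =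
      ENNReal.ofReal r ^ (5 / 4 : ℝ) := by
    have e2 : ENNReal.ofReal (r ^ 3) ^ (1 / 4 : ℝ) = ENNReal.ofReal r ^ (3 / 4 : ℝ) := by
      rw [ENNReal.ofReal_pow hr.le, ← ENNReal.rpow_natCast, ← ENNReal.rpow_mul]; norm_num
    have e3 : ENNReal.ofReal (r ^ 2) ^ (1 / 4 : ℝ) = ENNReal.ofReal r ^ (1 / 2 : ℝ) := by
      rw [ENNReal.ofReal_pow hr.le, ← ENNReal.rpow_natCast, ← ENNReal.rpow_mul]; norm_num
    rw [e2, e3, ← ENNReal.rpow_add _ _ hρ0 hρtop]; norm_num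
  -- assemble
  calc ∫⁻ p in parabolicCylinder r z, ‖v p.1 p.2‖ₑ ^ (3 : ℕ) = ∫⁻ s in I, cc s := hCeq
    _ ≤ K * (ENNReal.ofReal (r ^ 2) ^ (1 / 4 : ℝ) * (Θ + Λ) ^ (3 / 4 : ℝ)) := hIc
    _ = (C : ℝ≥0∞) * V₁ ^ (1 / 4 : ℝ) * ENNReal.ofReal M' ^ (3 / 2 : ℝ) *
          (ENNReal.ofReal (r ^ 3) ^ (1 / 4 : ℝ) * ENNReal.ofReal (r ^ 2) ^ (1 / 4 : ℝ)) *
          (Θ + Λ) ^ (3 / 4 : ℝ) := by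
        rw [hK, hVeq, ENNReal.mul_rpow_of_nonneg _ _ (by norm_num)]
        ring
    _ = (C : ℝ≥0∞) * V₁ ^ (1 / 4 : ℝ) * ENNReal.ofReal M' ^ (3 / 2 : ℝ) *
          ENNReal.ofReal r ^ (5 / 4 : ℝ) * (Θ + Λ) ^ (3 / 4 : ℝ) := by rw [hpow]
    _ ≤ (c : ℝ≥0∞) * ENNReal.ofReal M' ^ (3 / 2 : ℝ) * ENNReal.ofReal r ^ (5 / 4 : ℝ) *
          (Θ + Λ) ^ (3 / 4 : ℝ) := by
        rw [hcE]
        exact mul_le_mul_left (mul_le_mul_left (mul_le_mul_left le_self_add _) _) _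

/-- **Seregin–Zhou 2020, Lemma 2.4, estimate (C)** (tree form). There is an absolute constant
`c` such that: under `Hypotheses T v q G`, if `HeatBesovBound M (v t)` holds for a.e.
`t ∈ (0,T)`, then for every backward cylinder `Q(z, 2r)` with `0 ≤ t_z − (2r)²`, `t_z ≤ T`,
`C(r; z) ≤ c · max(M,1)^{3/2} · (A_ess(2r; z) + E(2r; z))^{3/4}`
(`C = cknC`, `A_ess = cknAEss`, `E = cknE`). Printed:
`C(z₀,r) ≤ c ‖u‖^{3/2}_{L_∞(0,T;Ḃ^{-1}_{∞,∞})} (A^{3/4}(z₀,2r) + E^{3/4}(z₀,2r))`.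
[cite: SereginZhou2020, Lemma 2.4 (C)] -/
theorem exists_cknC_le_rpow_three_quarters :
    ∃ c : ℝ≥0, ∀ (T : ℝ) (v : ℝ → EuclideanSpace ℝ (Fin 3) → EuclideanSpace ℝ (Fin 3))
      (q : ℝ → EuclideanSpace ℝ (Fin 3) → ℝ)
      (G : ℝ → EuclideanSpace ℝ (Fin 3) → EuclideanSpace ℝ (Fin 3) →L[ℝ] EuclideanSpace ℝ (Fin 3))
      (M : ℝ), Hypotheses T v q G →
      (∀ᵐ t : ℝ, t ∈ Ioo 0 T → HeatBesovBound M (v t)) →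
      ∀ (z : ℝ × EuclideanSpace ℝ (Fin 3)) (r : ℝ), 0 < r → 0 ≤ z.1 - (2 * r) ^ 2 → z.1 ≤ T →
        cknC r z v ≤ c * ENNReal.ofReal (max M 1) ^ (3 / 2 : ℝ) *
          (cknAEss (2 * r) z v + cknE (2 * r) z G) ^ (3 / 4 : ℝ) := by
  obtain ⟨c₀, h₀⟩ := exists_lintegral_parabolicCylinder_enorm_pow_three_le
  refine ⟨2 * c₀ + 1, fun T v q G M hyp hM z r hr hz0 hzT => ?_⟩
  set M' : ℝ := max M 1 with hM'
  have hM'0 : 0 < M' := lt_of_lt_of_le one_pos (le_max_right _ _)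
  have hM'e : ENNReal.ofReal M' ≠ 0 := by simpa using hM'0
  -- notation
  set t₀ : ℝ := z.1 with ht₀
  set x₀ : EuclideanSpace ℝ (Fin 3) := z.2 with hx₀
  set I : Set ℝ := Ioo (t₀ - r ^ 2) t₀ with hI
  set I₂ : Set ℝ := Ioo (t₀ - (2 * r) ^ 2) t₀ with hI₂
  set B₂ : Set (EuclideanSpace ℝ (Fin 3)) := ball x₀ (2 * r) with hB₂
  set A := cknAEss (2 * r) z v with hAdef
  set EE := cknE (2 * r) z G with hEdef
  have hcE : ((2 * c₀ + 1 : ℝ≥0) : ℝ≥0∞) = 2 * (c₀ : ℝ≥0∞) + 1 := by push_cast; rfl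
  have hc0 : ((2 * c₀ + 1 : ℝ≥0) : ℝ≥0∞) ≠ 0 := by rw [hcE]; simp
  -- degenerate cases
  have hRHS_top : ((2 * c₀ + 1 : ℝ≥0) : ℝ≥0∞) * ENNReal.ofReal M' ^ (3 / 2 : ℝ) *
      (⊤ : ℝ≥0∞) ^ (3 / 4 : ℝ) = ⊤ := by
    rw [ENNReal.top_rpow_of_pos (by norm_num), ENNReal.mul_top]
    exact mul_ne_zero hc0 (ENNReal.rpow_pos (pos_iff_ne_zero.2 hM'e) ENNReal.ofReal_ne_top).ne'
  by_cases hAtop : A = ⊤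
  · rw [hAtop, top_add, hRHS_top]; exact le_top
  by_cases hEtop : EE = ⊤
  · rw [hEtop, add_top, hRHS_top]; exact le_top
  -- geometry
  have hr2 : 0 < 2 * r := by positivity
  have hr2e : ENNReal.ofReal (2 * r) ≠ 0 := by simpa using hr2
  have hz0' : 0 ≤ z.1 - r ^ 2 := by nlinarith
  have hII₂ : I ⊆ I₂ := Ioo_subset_Ioo (by nlinarith) le_rfl
  have hQ₂ : parabolicCylinder (2 * r) z = I₂ ×ˢ B₂ := by
    simp [parabolicCylinder, hI₂, hB₂, ht₀, hx₀]
  have hsub : I ×ˢ B₂ ⊆ parabolicCylinder (2 * r) z := by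
    rw [hQ₂]; exact prod_mono hII₂ le_rfl
  -- the data of the fat cylinder `I × B(x,2r) ⊆ Q(z,2r)`
  have hΛ : ∀ᵐ s ∂(volume.restrict I),
      ∫⁻ y in B₂, ‖v s y‖ₑ ^ 2 ≤ ENNReal.ofReal (2 * r) * A := by
    have h : ∀ᵐ s ∂(volume.restrict I₂),
        (ENNReal.ofReal (2 * r))⁻¹ * ∫⁻ y in B₂, ‖v s y‖ₑ ^ 2 ≤ A := by
      rw [hAdef]; exact ENNReal.ae_le_essSup _
    refine ae_restrict_of_ae_restrict_of_subset hII₂ ?_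
    filter_upwards [h] with s hs
    calc ∫⁻ y in B₂, ‖v s y‖ₑ ^ 2
        = ENNReal.ofReal (2 * r) * ((ENNReal.ofReal (2 * r))⁻¹ * ∫⁻ y in B₂, ‖v s y‖ₑ ^ 2) := by
          rw [← mul_assoc, ENNReal.mul_inv_cancel hr2e ENNReal.ofReal_ne_top, one_mul]
      _ ≤ ENNReal.ofReal (2 * r) * A := mul_le_mul_right hs _
  have hΘ : ∫⁻ p in I ×ˢ B₂, ENNReal.ofReal (frobeniusNormSq (G p.1 p.2)) ≤
      ENNReal.ofReal (2 * r) * EE := by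
    have h1 : ENNReal.ofReal (2 * r) * EE =
        ∫⁻ p in parabolicCylinder (2 * r) z, ENNReal.ofReal (frobeniusNormSq (G p.1 p.2)) := by
      rw [hEdef, cknE, ← mul_assoc, ENNReal.mul_inv_cancel hr2e ENNReal.ofReal_ne_top, one_mul]
    rw [h1]; exact lintegral_mono_set hsub
  have key := h₀ T v q G M hyp hM z r (ENNReal.ofReal (2 * r) * A) hr hz0' hzT hΛ
  -- powers of `r`
  have hρ0 : ENNReal.ofReal r ≠ 0 := by simpa using hr
  have hρtop : ENNReal.ofReal r ≠ ⊤ := ENNReal.ofReal_ne_top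
  have hpow : (ENNReal.ofReal r ^ 2)⁻¹ * ENNReal.ofReal r ^ (5 / 4 : ℝ) *
      ENNReal.ofReal (2 * r) ^ (3 / 4 : ℝ) = ENNReal.ofReal 2 ^ (3 / 4 : ℝ) := by
    have e1 : (ENNReal.ofReal r ^ 2)⁻¹ = ENNReal.ofReal r ^ (-2 : ℝ) := by
      rw [← ENNReal.rpow_two, ENNReal.rpow_neg]
    have e4 : ENNReal.ofReal (2 * r) ^ (3 / 4 : ℝ) =
        ENNReal.ofReal 2 ^ (3 / 4 : ℝ) * ENNReal.ofReal r ^ (3 / 4 : ℝ) := by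
      rw [ENNReal.ofReal_mul (by norm_num), ENNReal.mul_rpow_of_nonneg _ _ (by norm_num)]
    rw [e1, e4]
    calc ENNReal.ofReal r ^ (-2 : ℝ) * ENNReal.ofReal r ^ (5 / 4 : ℝ) *
          (ENNReal.ofReal 2 ^ (3 / 4 : ℝ) * ENNReal.ofReal r ^ (3 / 4 : ℝ))
        = ENNReal.ofReal 2 ^ (3 / 4 : ℝ) * (ENNReal.ofReal r ^ (-2 : ℝ) *
            ENNReal.ofReal r ^ (5 / 4 : ℝ) * ENNReal.ofReal r ^ (3 / 4 : ℝ)) := by ring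
      _ = ENNReal.ofReal 2 ^ (3 / 4 : ℝ) * ENNReal.ofReal r ^ ((-2 : ℝ) + 5 / 4 + 3 / 4) := by
          rw [ENNReal.rpow_add _ _ hρ0 hρtop, ENNReal.rpow_add _ _ hρ0 hρtop]
      _ = ENNReal.ofReal 2 ^ (3 / 4 : ℝ) := by norm_num
  have h234 : ENNReal.ofReal 2 ^ (3 / 4 : ℝ) ≤ 2 := by
    rw [ENNReal.ofReal_ofNat]
    calc (2 : ℝ≥0∞) ^ (3 / 4 : ℝ) ≤ (2 : ℝ≥0∞) ^ (1 : ℝ) :=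
          ENNReal.rpow_le_rpow_of_exponent_le (by norm_num) (by norm_num)
      _ = 2 := ENNReal.rpow_one _
  -- assemble
  calc cknC r z v
      = (ENNReal.ofReal r ^ 2)⁻¹ * ∫⁻ p in parabolicCylinder r z, ‖v p.1 p.2‖ₑ ^ (3 : ℕ) := rfl
    _ ≤ (ENNReal.ofReal r ^ 2)⁻¹ * (c₀ * ENNReal.ofReal M' ^ (3 / 2 : ℝ) *
          ENNReal.ofReal r ^ (5 / 4 : ℝ) *
          ((∫⁻ p in I ×ˢ B₂, ENNReal.ofReal (frobeniusNormSq (G p.1 p.2))) +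
            ENNReal.ofReal (2 * r) * A) ^ (3 / 4 : ℝ)) := mul_le_mul_right key _
    _ ≤ (ENNReal.ofReal r ^ 2)⁻¹ * (c₀ * ENNReal.ofReal M' ^ (3 / 2 : ℝ) *
          ENNReal.ofReal r ^ (5 / 4 : ℝ) * (ENNReal.ofReal (2 * r) * (A + EE)) ^ (3 / 4 : ℝ)) := by
        refine mul_le_mul_right (mul_le_mul_right (ENNReal.rpow_le_rpow ?_ (by norm_num)) _) _
        rw [mul_add, add_comm (_ * A)]
        exact add_le_add hΘ le_rfl
    _ = c₀ * ENNReal.ofReal M' ^ (3 / 2 : ℝ) *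
          ((ENNReal.ofReal r ^ 2)⁻¹ * ENNReal.ofReal r ^ (5 / 4 : ℝ) *
            ENNReal.ofReal (2 * r) ^ (3 / 4 : ℝ)) * (A + EE) ^ (3 / 4 : ℝ) := by
        rw [ENNReal.mul_rpow_of_nonneg _ _ (by norm_num)]; ring
    _ = c₀ * ENNReal.ofReal M' ^ (3 / 2 : ℝ) * ENNReal.ofReal 2 ^ (3 / 4 : ℝ) *
          (A + EE) ^ (3 / 4 : ℝ) := by rw [hpow]
    _ ≤ c₀ * ENNReal.ofReal M' ^ (3 / 2 : ℝ) * 2 * (A + EE) ^ (3 / 4 : ℝ) :=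
        mul_le_mul_left (mul_le_mul_right h234 _) _
    _ ≤ ((2 * c₀ + 1 : ℝ≥0) : ℝ≥0∞) * ENNReal.ofReal M' ^ (3 / 2 : ℝ) * (A + EE) ^ (3 / 4 : ℝ) := by
        rw [hcE]
        calc (c₀ : ℝ≥0∞) * ENNReal.ofReal M' ^ (3 / 2 : ℝ) * 2 * (A + EE) ^ (3 / 4 : ℝ)
            = (2 * (c₀ : ℝ≥0∞)) * ENNReal.ofReal M' ^ (3 / 2 : ℝ) * (A + EE) ^ (3 / 4 : ℝ) := by
              ring
          _ ≤ (2 * (c₀ : ℝ≥0∞) + 1) * ENNReal.ofReal M' ^ (3 / 2 : ℝ) * (A + EE) ^ (3 / 4 : ℝ) :=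
              mul_le_mul_left (mul_le_mul_left le_self_add _) _

/-- **Finiteness of the cubic quantity on cylinders whose time window stays away from `t = 0`.**
Under `Hypotheses T v q G`, `C(r; z) < ∞` whenever
`0 < t_z − r²` and `t_z ≤ T`: the energy class of Def. 1.1 (i) on `(t_z − r², T) × B(x_z, 2r)`
feeds `exists_lintegral_parabolicCylinder_enorm_pow_three_le` (this covers cylinders touching
the final time `T`, where the tree's `IsSuitableWeakSolutionOn` gives no integrability).
[cite: SereginZhou2020, Def. 1.1 (i) and Lemma 2.4 (C)] -/
theorem Hypotheses.cknC_lt_top {T : ℝ} {v : ℝ → EuclideanSpace ℝ (Fin 3) → EuclideanSpace ℝ (Fin 3)}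
    {q : ℝ → EuclideanSpace ℝ (Fin 3) → ℝ}
    {G : ℝ → EuclideanSpace ℝ (Fin 3) → EuclideanSpace ℝ (Fin 3) →L[ℝ] EuclideanSpace ℝ (Fin 3)}
    (hyp : Hypotheses T v q G) {z : ℝ × EuclideanSpace ℝ (Fin 3)} {r : ℝ} (hr : 0 < r)
    (hz0 : 0 < z.1 - r ^ 2) (hzT : z.1 ≤ T) : cknC r z v < ⊤ := by
  obtain ⟨c₀, h₀⟩ := exists_lintegral_parabolicCylinder_enorm_pow_three_le
  obtain ⟨M, hM⟩ := hyp.besov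
  have hδT : z.1 - r ^ 2 < T := by nlinarith
  obtain ⟨⟨Cb, hCb⟩, hGfin, -⟩ :=
    hyp.energyClass (z.1 - r ^ 2) hz0 hδT z.2 (2 * r) (by positivity)
  have hI : Ioo (z.1 - r ^ 2) z.1 ⊆ Ioo (z.1 - r ^ 2) T := Ioo_subset_Ioo le_rfl hzT
  have hΛ : ∀ᵐ s ∂(volume.restrict (Ioo (z.1 - r ^ 2) z.1)),
      ∫⁻ y in ball z.2 (2 * r), ‖v s y‖ₑ ^ 2 ≤ Cb := by
    rw [ae_restrict_iff' measurableSet_Ioo]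
    filter_upwards [hCb] with s hs hsI using hs (hI hsI)
  have key := h₀ T v q G M hyp hM z r Cb hr hz0.le hzT hΛ
  have hΘ : ∫⁻ p in Ioo (z.1 - r ^ 2) z.1 ×ˢ ball z.2 (2 * r),
      ENNReal.ofReal (frobeniusNormSq (G p.1 p.2)) < ⊤ :=
    lt_of_le_of_lt (lintegral_mono_set (prod_mono hI le_rfl)) hGfin
  have hρ0 : ENNReal.ofReal r ≠ 0 := by simpa using hr
  change (ENNReal.ofReal r ^ 2)⁻¹ * ∫⁻ p in parabolicCylinder r z, ‖v p.1 p.2‖ₑ ^ (3 : ℕ) < ⊤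
  refine ENNReal.mul_lt_top (ENNReal.inv_lt_top.2 (pos_iff_ne_zero.2 (pow_ne_zero _ hρ0))) ?_
  refine lt_of_le_of_lt key ?_
  refine ENNReal.mul_lt_top (ENNReal.mul_lt_top (ENNReal.mul_lt_top ENNReal.coe_lt_top
    (ENNReal.rpow_lt_top_of_nonneg (by norm_num) ENNReal.ofReal_ne_top))
    (ENNReal.rpow_lt_top_of_nonneg (by norm_num) ENNReal.ofReal_ne_top)) ?_
  exact ENNReal.rpow_lt_top_of_nonneg (by norm_num)
    (ENNReal.add_ne_top.2 ⟨hΘ.ne, ENNReal.coe_ne_top⟩)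

end SereginZhou2020

end Literature.Analysis.FluidPDE
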